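import Summits.FinalStateConjecture.FinalStateConjecture.Theorems.EIHFluxBalanceInertialRecessionLorentz
import Literature.Geometry.Lorentzian.KerrWaveDecay
import Literature.Geometry.Lorentzian.KerrHyperboloidalLeaves
import Literature.Geometry.Lorentzian.SlabTransportUniqueness
import Literature.Geometry.Lorentzian.KerrSchildEnergyEstimate

/-!
# Crux `AdiabaticMultiKerrILED` (line `Sketch`) — fixed-time Hardy bounds for the far-field transport

Helper file for the far-field Morawetz transport stub `stub_farTransport` of the line `Sketch`
(crux item `stmt-FinalStateConjecture-14310`, route `ClusterCompleteness`).

At a fixed lab time the boundary term `J⁰` and the error term of the cut-off Morawetz current obey a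
three-term pointwise bound (`abs_farCurrent_le`):
`|F| ≤ 5 ζ P + 12 ζ w²/(‖y‖+R)² + |ζ'| w²/(‖y‖+R)`, where `P = ∑_μ (∂_μ ψ)²` on the slice,
`w = ψ − c`, `ζ` the zone cut-off and `ζ'` a derivative of it (supported on the shells).  This file
turns that pointwise bound into the `L¹` bound `∫ |F| ≤ C · ∫_{Ext} P` using the perforated Hardy
inequality (registered stub `stub_perforatedHardy`, taken here as the hypothesis `hPH`) twice —
once centred at the origin, once at each centre `cᵢ` for the shell terms — together with the
elementary fact that the slice gradient is dominated by the space-time gradient.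

## Main statements

* `norm_fderiv_slice_sq_le` : `‖∇_y[w(t,·)](y)‖² ≤ ∑_μ (∂_μ w)(t,y)²`.
* `lintegral_sq_div_norm_sub_sq_le_of_PH` : Hardy bound on `{∀ j, 16Mⱼ < ‖y − cⱼ‖}` with any
  centre `y₀`, from `hPH` with holes of radii `8Mᵢ`.
* `lintegral_abs_le_energy_of_farBound` : the fixed-time `L¹` bound (registered sub-goal).
-/

noncomputable section

set_option linter.dupNamespace false

open scoped ContDiff Topology ENNReal
open Filter Set MeasureTheory Literature.Geometry.Lorentzian Summit.FinalStateConjecture.FinalStateConjecture.Theorems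

namespace Summit.FinalStateConjecture.FinalStateConjecture.Cruxes.AdiabaticMultiKerrILED.Sketch

/-! ### The slice gradient is below the space-time gradient -/

/-- `‖ℓ ∘ (0, ·)‖² ≤ ∑_μ ℓ(∂_μ)²` for a functional on `E4`. [folklore] -/
theorem norm_comp_spaceEmbed_sq_le' (ℓ : E4 →L[ℝ] ℝ) :
    ‖ℓ.comp E4.spaceEmbed‖ ^ 2 ≤ ∑ μ : Fin 4, (ℓ (E4.basisVector μ)) ^ 2 := by
  set A : ℝ := Real.sqrt (∑ m : Fin 3, (ℓ (E4.basisVector m.succ)) ^ 2) with hA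
  have hA0 : 0 ≤ A := Real.sqrt_nonneg _
  have hbound : ∀ v : E3, ‖ℓ.comp E4.spaceEmbed v‖ ≤ A * ‖v‖ := by
    intro v
    rw [ContinuousLinearMap.comp_apply, E4.spaceEmbed_eq_sum, map_sum, Real.norm_eq_abs]
    simp only [map_smul, smul_eq_mul]
    have hcs := Finset.sum_mul_sq_le_sq_mul_sq Finset.univ (fun m : Fin 3 ↦ v m)
      (fun m ↦ ℓ (E4.basisVector m.succ))
    have hv : ‖v‖ = Real.sqrt (∑ m : Fin 3, (v m) ^ 2) := by
      rw [EuclideanSpace.norm_eq]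
      simp [Real.norm_eq_abs, sq_abs]
    rw [hv, hA, ← Real.sqrt_mul (Finset.sum_nonneg fun _ _ ↦ sq_nonneg _), ← Real.sqrt_sq_eq_abs]
    exact Real.sqrt_le_sqrt (by nlinarith [hcs])
  have hop : ‖ℓ.comp E4.spaceEmbed‖ ≤ A := ContinuousLinearMap.opNorm_le_bound _ hA0 hbound
  have hsq : ‖ℓ.comp E4.spaceEmbed‖ ^ 2 ≤ A ^ 2 := pow_le_pow_left₀ (norm_nonneg _) hop 2
  rw [hA, Real.sq_sqrt (Finset.sum_nonneg fun _ _ ↦ sq_nonneg _)] at hsq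
  refine hsq.trans ?_
  conv_rhs => rw [Fin.sum_univ_succ]
  nlinarith [sq_nonneg (ℓ (E4.basisVector 0))]

/-- `‖∇_y [w(t, ·)](y)‖² ≤ ∑_μ (∂_μ w)(t, y)²` for `w` differentiable at `(t, y)`. [folklore] -/
theorem norm_fderiv_slice_sq_le {w : E4 → ℝ} {t : ℝ} {y : E3}
    (hw : DifferentiableAt ℝ w (E4.ofTimeSpace t y)) :
    ‖fderiv ℝ (fun z : E3 ↦ w (E4.ofTimeSpace t z)) y‖ ^ 2 ≤
      ∑ μ : Fin 4, (fderiv ℝ w (E4.ofTimeSpace t y) (E4.basisVector μ)) ^ 2 := by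
  have h : fderiv ℝ (fun z : E3 ↦ w (E4.ofTimeSpace t z)) y =
      (fderiv ℝ w (E4.ofTimeSpace t y)).comp E4.spaceEmbed :=
    (hw.hasFDerivAt.comp y (E4.hasFDerivAt_ofTimeSpace t y)).fderiv
  rw [h]
  exact norm_comp_spaceEmbed_sq_le' _

/-! ### The perforated Hardy inequality at a fixed lab time -/

/-- **Fixed-time exterior Hardy bounds.** Given the perforated Hardy inequality (registered stub
`stub_perforatedHardy`, hypothesis `hPH` with its constant `K`), centres `cᵢ` that are
`32(Mᵢ + Mⱼ)`-separated, and a `C¹` slice function `f` in the Hardy class far out: for every centre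
`y₀`, `∫_{∀ j, 16Mⱼ < ‖y − cⱼ‖} f²/‖y − y₀‖² ≤ K ∫_{∀ j, 8Mⱼ < ‖y − cⱼ‖} ‖Df‖²`. [folklore] -/
theorem lintegral_sq_div_norm_sub_sq_le_of_PH {K : NNReal}
    (hPH : ∀ (n : ℕ) (c : Fin n → E3) (ρ : Fin n → ℝ), (∀ i, 0 < ρ i) →
      (∀ i j, i ≠ j → 4 * (ρ i + ρ j) ≤ dist (c i) (c j)) →
      ∀ φ : E3 → ℝ, (∀ y : E3, (∀ i, ρ i < dist y (c i)) → ContDiffAt ℝ 1 φ y) →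
      (∃ ρ₀ : ℝ, ∫⁻ y in {y : E3 | ρ₀ < ‖y‖}, ENNReal.ofReal (φ y ^ 2 / ‖y‖ ^ 2) < ⊤) →
      ∀ y₀ : E3, ∫⁻ y in {y : E3 | ∀ i, 2 * ρ i < dist y (c i)},
          ENNReal.ofReal (φ y ^ 2 / ‖y - y₀‖ ^ 2) ≤
        (K : ENNReal) * ∫⁻ y in {y : E3 | ∀ i, ρ i < dist y (c i)}, ENNReal.ofReal (‖fderiv ℝ φ y‖ ^ 2))
    {N : ℕ} {M : Fin N → ℝ} {c : Fin N → E3} (hM : ∀ i, 0 < M i)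
    (hsep : ∀ i j, i ≠ j → 32 * (M i + M j) ≤ ‖c i - c j‖)
    {f : E3 → ℝ} (hf : ContDiff ℝ 1 f)
    (hdec : ∃ ρ₀ : ℝ, ∫⁻ y in {y : E3 | ρ₀ < ‖y‖}, ENNReal.ofReal (f y ^ 2 / ‖y‖ ^ 2) < ⊤) (y₀ : E3) :
    ∫⁻ y in {y : E3 | ∀ j, 16 * M j < ‖y - c j‖}, ENNReal.ofReal (f y ^ 2 / ‖y - y₀‖ ^ 2) ≤
      (K : ENNReal) * ∫⁻ y in {y : E3 | ∀ j, 8 * M j < ‖y - c j‖}, ENNReal.ofReal (‖fderiv ℝ f y‖ ^ 2) := by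
  have h := hPH N c (fun j ↦ 8 * M j) (fun j ↦ by have := hM j; positivity)
    (fun i j hij ↦ by rw [dist_eq_norm]; linarith [hsep i j hij]) f (fun y _ ↦ hf.contDiffAt) hdec y₀
  have hs1 : {y : E3 | ∀ j, 2 * (8 * M j) < dist y (c j)} = {y : E3 | ∀ j, 16 * M j < ‖y - c j‖} := by
    ext y; simp only [mem_setOf_eq, dist_eq_norm]
    exact forall_congr' fun j ↦ by constructor <;> intro h' <;> linarith
  have hs2 : {y : E3 | ∀ j, 8 * M j < dist y (c j)} = {y : E3 | ∀ j, 8 * M j < ‖y - c j‖} := by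
    ext y; simp only [mem_setOf_eq, dist_eq_norm]
  rw [hs1, hs2] at h
  exact h

/-- **The exterior slice energy is below the space-time energy**: if `{∀ j, 8Mⱼ < ‖y − cⱼ‖}` lies in
the exterior slice, then `∫_{∀ j, 8Mⱼ < ‖y − cⱼ‖} ‖∇_y φ(t,·)‖² ≤ ∫_{exterior} ∑_μ (∂_μφ)²`. [folklore] -/
theorem lintegral_norm_fderiv_slice_le {N : ℕ} {M : Fin N → ℝ} {c : Fin N → E3} {t : ℝ}
    {Ext : Set E3} (hext : ∀ y : E3, (∀ j, 8 * M j < ‖y - c j‖) → y ∈ Ext)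
    {φ : E4 → ℝ} (hφ : ContDiff ℝ 1 φ) :
    ∫⁻ y in {y : E3 | ∀ j, 8 * M j < ‖y - c j‖},
        ENNReal.ofReal (‖fderiv ℝ (fun z : E3 ↦ φ (E4.ofTimeSpace t z)) y‖ ^ 2) ≤
      ∫⁻ y in Ext, ENNReal.ofReal (∑ μ : Fin 4, (fderiv ℝ φ (E4.ofTimeSpace t y) (E4.basisVector μ)) ^ 2) := by
  refine (lintegral_mono fun y ↦ ENNReal.ofReal_le_ofReal ?_).trans (lintegral_mono_set fun y hy ↦ hext y hy)
  exact norm_fderiv_slice_sq_le ((hφ.differentiable one_ne_zero) _)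

/-! ### The fixed-time `L¹` bound of the far current's density -/

/-- **Fixed-time `L¹` bound through the exterior energy.** Let `F : E3 → ℝ` (a component of the far
current on the slice `t`) satisfy the three-term pointwise bound of `abs_farCurrent_le`,
`|F y| ≤ 5 ζ P + 12 ζ w²/(‖y‖ + R)² + |ζ'| w²/(‖y‖ + R)` with `0 ≤ ζ ≤ 1`, `ζ ≠ 0` only on
`{∀ j, 17Mⱼ ≤ ‖y − cⱼ‖}`, `ζ' ≠ 0` only on the shells `{∃ i, ‖y − cᵢ‖ ≤ 34Mᵢ} ∩ {∀ j, 17Mⱼ ≤ ‖y − cⱼ‖}`,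
`|ζ'| ≤ K_ζ`; let the centres be `32(Mᵢ+Mⱼ)`-separated, `{∀ j, 8Mⱼ < ‖y − cⱼ‖} ⊆ Ext`, the slice
function `w` `C¹` and in the Hardy class far out, and let the perforated Hardy inequality hold with
constant `K`. Then `∫ |F| ≤ (5 + 12K + (K_ζ/R) · 1156 K ∑ᵢ Mᵢ²) ∫_{Ext} P`. [folklore] -/
theorem lintegral_abs_le_energy_of_farBound {K : NNReal}
    (hPH : ∀ (n : ℕ) (c : Fin n → E3) (ρ : Fin n → ℝ), (∀ i, 0 < ρ i) →
      (∀ i j, i ≠ j → 4 * (ρ i + ρ j) ≤ dist (c i) (c j)) →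
      ∀ φ : E3 → ℝ, (∀ y : E3, (∀ i, ρ i < dist y (c i)) → ContDiffAt ℝ 1 φ y) →
      (∃ ρ₀ : ℝ, ∫⁻ y in {y : E3 | ρ₀ < ‖y‖}, ENNReal.ofReal (φ y ^ 2 / ‖y‖ ^ 2) < ⊤) →
      ∀ y₀ : E3, ∫⁻ y in {y : E3 | ∀ i, 2 * ρ i < dist y (c i)},
          ENNReal.ofReal (φ y ^ 2 / ‖y - y₀‖ ^ 2) ≤
        (K : ENNReal) * ∫⁻ y in {y : E3 | ∀ i, ρ i < dist y (c i)}, ENNReal.ofReal (‖fderiv ℝ φ y‖ ^ 2))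
    {N : ℕ} {M : Fin N → ℝ} {c : Fin N → E3} (hM : ∀ i, 0 < M i)
    (hsep : ∀ i j, i ≠ j → 32 * (M i + M j) ≤ ‖c i - c j‖)
    {Ext : Set E3} (hext : ∀ y : E3, (∀ j, 8 * M j < ‖y - c j‖) → y ∈ Ext)
    (hExtm : MeasurableSet Ext)
    {w : E3 → ℝ} (hw : ContDiff ℝ 1 w)
    (hdec : ∃ ρ₀ : ℝ, ∫⁻ y in {y : E3 | ρ₀ < ‖y‖}, ENNReal.ofReal (w y ^ 2 / ‖y‖ ^ 2) < ⊤)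
    {P ζ ζ' F : E3 → ℝ} (hPm : Measurable P) (hP0 : ∀ y, 0 ≤ P y)
    (hwP : ∀ y, ‖fderiv ℝ w y‖ ^ 2 ≤ P y) (hζ01 : ∀ y, 0 ≤ ζ y ∧ ζ y ≤ 1)
    (hζsupp : ∀ y, ζ y ≠ 0 → ∀ j, 17 * M j ≤ ‖y - c j‖)
    (hζ'supp : ∀ y, ζ' y ≠ 0 → (∃ i, ‖y - c i‖ ≤ 34 * M i) ∧ ∀ j, 17 * M j ≤ ‖y - c j‖)
    {Kζ R : ℝ} (hKζ : ∀ y, |ζ' y| ≤ Kζ) (hR : 0 < R)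
    (hF : ∀ y, |F y| ≤ 5 * ζ y * P y + 12 * ζ y * (w y ^ 2 / (‖y‖ + R) ^ 2) +
      |ζ' y| * (w y ^ 2 / (‖y‖ + R))) :
    ∫⁻ y, ENNReal.ofReal (|F y|) ≤
      ENNReal.ofReal (5 + 12 * K + Kζ / R * (1156 * K * ∑ i, M i ^ 2)) *
        ∫⁻ y in Ext, ENNReal.ofReal (P y) := by
  -- notation
  set I : ℝ≥0∞ := ∫⁻ y in Ext, ENNReal.ofReal (P y) with hI
  set Far16 : Set E3 := {y : E3 | ∀ j, 16 * M j < ‖y - c j‖} with hFar16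
  have hFar16m : MeasurableSet Far16 := by
    have : Far16 = ⋂ j, {y : E3 | 16 * M j < ‖y - c j‖} := by ext y; simp [hFar16]
    rw [this]
    exact MeasurableSet.iInter fun j ↦
      (isOpen_lt continuous_const (continuous_id.sub continuous_const).norm).measurableSet
  have hKζ0 : 0 ≤ Kζ := (abs_nonneg _).trans (hKζ 0)
  -- the exterior slice energy
  have hE' : ∫⁻ y in {y : E3 | ∀ j, 8 * M j < ‖y - c j‖}, ENNReal.ofReal (‖fderiv ℝ w y‖ ^ 2) ≤ I :=
    (lintegral_mono fun y ↦ ENNReal.ofReal_le_ofReal (hwP y)).trans (lintegral_mono_set fun y hy ↦ hext y hy)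
  -- the two Hardy integrals
  have hH0 : ∫⁻ y in Far16, ENNReal.ofReal (w y ^ 2 / ‖y‖ ^ 2) ≤ K * I := by
    have h := lintegral_sq_div_norm_sub_sq_le_of_PH hPH hM hsep hw hdec (0 : E3)
    simp only [sub_zero] at h
    exact h.trans (mul_le_mul' le_rfl hE')
  have hHi : ∀ i, ∫⁻ y in Far16, ENNReal.ofReal (w y ^ 2 / ‖y - c i‖ ^ 2) ≤ K * I := fun i ↦
    (lintegral_sq_div_norm_sub_sq_le_of_PH hPH hM hsep hw hdec (c i)).trans (mul_le_mul' le_rfl hE')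
  -- support consequences
  have h17_16 : ∀ y, (∀ j, 17 * M j ≤ ‖y - c j‖) → y ∈ Far16 := fun y hy j ↦ by
    have := hy j; have := hM j; show 16 * M j < ‖y - c j‖; linarith
  have h17_ext : ∀ y, (∀ j, 17 * M j ≤ ‖y - c j‖) → y ∈ Ext := fun y hy ↦
    hext y fun j ↦ by have := hy j; have := hM j; linarith
  -- the pointwise almost-everywhere majorant
  set G1 : E3 → ℝ≥0∞ := fun y ↦ Ext.indicator (fun y ↦ ENNReal.ofReal (P y)) y with hG1
  set G2 : E3 → ℝ≥0∞ := fun y ↦ Far16.indicator (fun y ↦ ENNReal.ofReal (w y ^ 2 / ‖y‖ ^ 2)) y with hG2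
  set G3 : Fin N → E3 → ℝ≥0∞ := fun i y ↦
    Far16.indicator (fun y ↦ ENNReal.ofReal (w y ^ 2 / ‖y - c i‖ ^ 2)) y with hG3
  have hmaj : ∀ᵐ y ∂(volume : Measure E3), ENNReal.ofReal (|F y|) ≤
      5 * G1 y + 12 * G2 y + ENNReal.ofReal (Kζ / R) * ∑ i, ENNReal.ofReal (1156 * M i ^ 2) * G3 i y := by
    have hae : ∀ᵐ y ∂(volume : Measure E3), y ≠ 0 := by
      have : (volume : Measure E3) {(0 : E3)} = 0 := measure_singleton 0
      rw [ae_iff]; simp [this]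
    filter_upwards [hae] with y hy0
    have hζ0 := (hζ01 y).1; have hζ1 := (hζ01 y).2
    have hw2 : 0 ≤ w y ^ 2 := sq_nonneg _
    have hyn : 0 < ‖y‖ := norm_pos_iff.mpr hy0
    -- term 1
    have ht1 : ENNReal.ofReal (5 * ζ y * P y) ≤ 5 * G1 y := by
      by_cases hz : ζ y = 0
      · simp [hz]
      · have hmem : y ∈ Ext := h17_ext y (hζsupp y hz)
        simp only [hG1, indicator_of_mem hmem]
        rw [show (5 : ℝ≥0∞) = ENNReal.ofReal 5 by norm_num, ← ENNReal.ofReal_mul (by norm_num)]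
        exact ENNReal.ofReal_le_ofReal (by nlinarith [hP0 y])
    -- term 2
    have ht2 : ENNReal.ofReal (12 * ζ y * (w y ^ 2 / (‖y‖ + R) ^ 2)) ≤ 12 * G2 y := by
      by_cases hz : ζ y = 0
      · simp [hz]
      · have hmem : y ∈ Far16 := h17_16 y (hζsupp y hz)
        simp only [hG2, indicator_of_mem hmem]
        rw [show (12 : ℝ≥0∞) = ENNReal.ofReal 12 by norm_num, ← ENNReal.ofReal_mul (by norm_num)]
        refine ENNReal.ofReal_le_ofReal ?_
        have hfrac : w y ^ 2 / (‖y‖ + R) ^ 2 ≤ w y ^ 2 / ‖y‖ ^ 2 := by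
          apply div_le_div_of_nonneg_left hw2 (by positivity)
          exact pow_le_pow_left₀ hyn.le (by linarith) 2
        nlinarith [hfrac, div_nonneg hw2 (sq_nonneg ‖y‖)]
    -- term 3
    have ht3 : ENNReal.ofReal (|ζ' y| * (w y ^ 2 / (‖y‖ + R))) ≤
        ENNReal.ofReal (Kζ / R) * ∑ i, ENNReal.ofReal (1156 * M i ^ 2) * G3 i y := by
      by_cases hz : ζ' y = 0
      · simp [hz]
      · obtain ⟨⟨i, hi⟩, hfar⟩ := hζ'supp y hz
        have hmem : y ∈ Far16 := h17_16 y hfar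
        have hci : 0 < ‖y - c i‖ := by have := hfar i; have := hM i; linarith
        -- single term of the sum
        have hsingle : ENNReal.ofReal (1156 * M i ^ 2) * G3 i y ≤
            ∑ i, ENNReal.ofReal (1156 * M i ^ 2) * G3 i y :=
          Finset.single_le_sum (f := fun i ↦ ENNReal.ofReal (1156 * M i ^ 2) * G3 i y)
            (fun _ _ ↦ bot_le) (Finset.mem_univ i)
        refine le_trans ?_ (mul_le_mul' le_rfl hsingle)
        simp only [hG3, indicator_of_mem hmem]
        rw [← ENNReal.ofReal_mul (by positivity), ← ENNReal.ofReal_mul (by positivity)]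
        refine ENNReal.ofReal_le_ofReal ?_
        have hwc : w y ^ 2 ≤ 1156 * M i ^ 2 * (w y ^ 2 / ‖y - c i‖ ^ 2) := by
          have hsq : ‖y - c i‖ ^ 2 ≤ 1156 * M i ^ 2 := by nlinarith [norm_nonneg (y - c i)]
          calc w y ^ 2 = w y ^ 2 / ‖y - c i‖ ^ 2 * ‖y - c i‖ ^ 2 := by field_simp
            _ ≤ w y ^ 2 / ‖y - c i‖ ^ 2 * (1156 * M i ^ 2) :=
                mul_le_mul_of_nonneg_left hsq (div_nonneg hw2 (sq_nonneg _))
            _ = 1156 * M i ^ 2 * (w y ^ 2 / ‖y - c i‖ ^ 2) := by ring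
        have hinv : w y ^ 2 / (‖y‖ + R) ≤ w y ^ 2 / R :=
          div_le_div_of_nonneg_left hw2 hR (by linarith [norm_nonneg y])
        calc |ζ' y| * (w y ^ 2 / (‖y‖ + R)) ≤ Kζ * (w y ^ 2 / R) :=
              mul_le_mul (hKζ y) hinv (div_nonneg hw2 (by linarith [norm_nonneg y])) hKζ0
          _ = Kζ / R * w y ^ 2 := by ring
          _ ≤ Kζ / R * (1156 * M i ^ 2 * (w y ^ 2 / ‖y - c i‖ ^ 2)) :=
              mul_le_mul_of_nonneg_left hwc (div_nonneg hKζ0 hR.le)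
    -- combine the three terms
    have hsum : |F y| ≤ 5 * ζ y * P y + 12 * ζ y * (w y ^ 2 / (‖y‖ + R) ^ 2) +
        |ζ' y| * (w y ^ 2 / (‖y‖ + R)) := hF y
    have hnn1 : 0 ≤ 5 * ζ y * P y := by have := hP0 y; positivity
    have hnn2 : 0 ≤ 12 * ζ y * (w y ^ 2 / (‖y‖ + R) ^ 2) := by positivity
    have hnn3 : 0 ≤ |ζ' y| * (w y ^ 2 / (‖y‖ + R)) := by
      have : 0 ≤ w y ^ 2 / (‖y‖ + R) := div_nonneg hw2 (by linarith [norm_nonneg y])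
      positivity
    calc ENNReal.ofReal (|F y|)
        ≤ ENNReal.ofReal (5 * ζ y * P y + 12 * ζ y * (w y ^ 2 / (‖y‖ + R) ^ 2) +
            |ζ' y| * (w y ^ 2 / (‖y‖ + R))) := ENNReal.ofReal_le_ofReal hsum
      _ = ENNReal.ofReal (5 * ζ y * P y) + ENNReal.ofReal (12 * ζ y * (w y ^ 2 / (‖y‖ + R) ^ 2)) +
            ENNReal.ofReal (|ζ' y| * (w y ^ 2 / (‖y‖ + R))) := by
          rw [ENNReal.ofReal_add (by positivity) hnn3, ENNReal.ofReal_add hnn1 hnn2]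
      _ ≤ 5 * G1 y + 12 * G2 y + ENNReal.ofReal (Kζ / R) * ∑ i, ENNReal.ofReal (1156 * M i ^ 2) * G3 i y :=
          add_le_add (add_le_add ht1 ht2) ht3
  -- measurability of the majorant pieces
  have hwm : Measurable w := hw.continuous.measurable
  have hG1m : Measurable G1 := (ENNReal.measurable_ofReal.comp hPm).indicator hExtm
  have hG2m : Measurable G2 :=
    (ENNReal.measurable_ofReal.comp ((hwm.pow_const 2).div (measurable_norm.pow_const 2))).indicator hFar16m
  have hG3m : ∀ i, Measurable (G3 i) := fun i ↦
    (ENNReal.measurable_ofReal.comp ((hwm.pow_const 2).div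
      ((measurable_id.sub measurable_const).norm.pow_const 2))).indicator hFar16m
  -- integrate
  have hint1 : ∫⁻ y, G1 y = I := by rw [hG1, lintegral_indicator hExtm]
  have hint2 : ∫⁻ y, G2 y ≤ K * I := by rw [hG2, lintegral_indicator hFar16m]; exact hH0
  have hint3 : ∀ i, ∫⁻ y, G3 i y ≤ K * I := fun i ↦ by rw [hG3, lintegral_indicator hFar16m]; exact hHi i
  calc ∫⁻ y, ENNReal.ofReal (|F y|)
      ≤ ∫⁻ y, (5 * G1 y + 12 * G2 y + ENNReal.ofReal (Kζ / R) * ∑ i, ENNReal.ofReal (1156 * M i ^ 2) * G3 i y) :=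
        lintegral_mono_ae hmaj
    _ = 5 * (∫⁻ y, G1 y) + 12 * (∫⁻ y, G2 y) +
          ENNReal.ofReal (Kζ / R) * ∑ i, (ENNReal.ofReal (1156 * M i ^ 2) * ∫⁻ y, G3 i y) := by
        have hm12 : Measurable fun y ↦ 5 * G1 y + 12 * G2 y := (hG1m.const_mul _).add (hG2m.const_mul _)
        have hm1 : Measurable fun y ↦ 5 * G1 y := hG1m.const_mul _
        have hm3 : Measurable fun y ↦ ∑ i, ENNReal.ofReal (1156 * M i ^ 2) * G3 i y :=
          Finset.measurable_sum _ fun i _ ↦ (hG3m i).const_mul _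
        rw [lintegral_add_left hm12, lintegral_add_left hm1, lintegral_const_mul _ hG1m,
          lintegral_const_mul _ hG2m, lintegral_const_mul _ hm3,
          lintegral_finsetSum _ fun i _ ↦ (hG3m i).const_mul _]
        congr 2
        exact Finset.sum_congr rfl fun i _ ↦ lintegral_const_mul _ (hG3m i)
    _ ≤ 5 * I + 12 * (K * I) + ENNReal.ofReal (Kζ / R) * ∑ i, ENNReal.ofReal (1156 * M i ^ 2) * (K * I) := by
        rw [hint1]
        gcongr with i
        exact hint3 _
    _ = ENNReal.ofReal (5 + 12 * K + Kζ / R * (1156 * K * ∑ i, M i ^ 2)) * I := by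
        -- real bookkeeping of the constant
        have hK : (K : ℝ≥0∞) = ENNReal.ofReal (K : ℝ) := (ENNReal.ofReal_coe_nnreal).symm
        have hsumM : ∑ i, ENNReal.ofReal (1156 * M i ^ 2) * ((K : ℝ≥0∞) * I) =
            ENNReal.ofReal (1156 * K * ∑ i, M i ^ 2) * I := by
          rw [← Finset.sum_mul, ← mul_assoc]
          congr 1
          rw [hK, ← ENNReal.ofReal_sum_of_nonneg (fun i _ ↦ by positivity),
            ← ENNReal.ofReal_mul (Finset.sum_nonneg fun i _ ↦ by positivity)]
          congr 1
          rw [Finset.mul_sum, Finset.sum_mul]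
          exact Finset.sum_congr rfl fun i _ ↦ by ring
        rw [hsumM]
        have h5 : (5 : ℝ≥0∞) = ENNReal.ofReal 5 := by norm_num
        have h12 : (12 : ℝ≥0∞) = ENNReal.ofReal 12 := by norm_num
        have hnn3 : 0 ≤ Kζ / R * (1156 * K * ∑ i, M i ^ 2) :=
          mul_nonneg (div_nonneg hKζ0 hR.le) (by positivity)
        have hconst : ENNReal.ofReal (5 + 12 * K + Kζ / R * (1156 * K * ∑ i, M i ^ 2)) =
            ENNReal.ofReal 5 + ENNReal.ofReal 12 * ENNReal.ofReal K +
              ENNReal.ofReal (Kζ / R) * ENNReal.ofReal (1156 * K * ∑ i, M i ^ 2) := by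
          rw [ENNReal.ofReal_add (by positivity) hnn3, ENNReal.ofReal_add (by norm_num) (by positivity),
            ENNReal.ofReal_mul (by norm_num), ENNReal.ofReal_mul (div_nonneg hKζ0 hR.le)]
        rw [hconst, h5, h12, hK]
        ring

end Summit.FinalStateConjecture.FinalStateConjecture.Cruxes.AdiabaticMultiKerrILED.Sketch

end
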